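import Mathlib.Analysis.SpecialFunctions.Pow.Real
import HarnessLib

/-!
# Route `RoughParitySectors`, crux `OddSectorShareLinear` (stmt-Parity-15629), line `birth`:
# helpers for the stub `stub_shareOfDecoupling` — the relative-error bookkeeping of the member step

`--supports stmt-Parity-15629` file (registered sub-goal `stub_shareChain`). The line `birth` proves
the crux `|c₁·(U e^{−γ}/2)^k − c_odd| ≤ η·c_odd` member by member: each member step is a chain of
relative-error ("share") statements of the iterated-limit shape
`∀ η > 0, ∃ U₀, ∀ U ≥ U₀, eventually in x, |a − b| ≤ η·b`.  This file is the def-free glue, over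
ABSTRACT cells (functions `ℝ → ℕ → ℕ` of `(U, x)`), so that the main file
`RoughParitySectorsOddSectorShareLinearShareOfDecoupling.lean` only instantiates:

* `share_ratio_of_factor`, `ratio_ev` — S' = S'a ∧ S'b: `P ≈ W·Q` and `O ≈ W·N` with the SAME sieve
  factor `W ≥ 0` give `P·N ≈ O·Q`;
* `share_chain2`, `sifted_ev` — S = S' ∘ S'': `P·N ≈ O·Q` and `Q·Oz ≈ N·Pz` give `P·Oz ≈ O·Pz`
  (`P ≤ Q ≤ N`, `O ≤ N`);
* `share_chain` (= the registered sub-goal `stub_shareChain`), `memberStep_ev` — D, S, Z chain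
  multiplicatively to the member step `|c⁽ᵐ⁺¹⁾·A(U) − c⁽ᵐ⁾| ≤ η·c⁽ᵐ⁾`.

Pure real analysis; no number theory is used here.
-/

noncomputable section

open Filter

namespace Summit.Parity.BatemanHorn.Cruxes.OddSectorShareLinear.Birth

namespace ShareOfDecoupling

/-! ### Pure-real bookkeeping -/

/-- Two one-sided sieve statements with the SAME factor give the ratio statement: with
`W, Q, N ≥ 0`, `0 ≤ η ≤ 1/2`, `|P − WQ| ≤ ηWQ` and `|O − WN| ≤ ηWN` imply `|P·N − O·Q| ≤ 4η·O·Q`.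
[folklore] -/
theorem share_ratio_of_factor {P O Q N W η : ℝ} (hη0 : 0 ≤ η) (hη1 : η ≤ 1 / 2)
    (hW : 0 ≤ W) (hQ : 0 ≤ Q) (hN : 0 ≤ N)
    (h1 : |P - W * Q| ≤ η * (W * Q)) (h2 : |O - W * N| ≤ η * (W * N)) :
    |P * N - O * Q| ≤ 4 * η * (O * Q) := by
  rw [abs_le] at h1 h2 ⊢
  obtain ⟨h1a, h1b⟩ := h1
  obtain ⟨h2a, h2b⟩ := h2
  have hWQN : 0 ≤ W * Q * N := by positivity
  -- `P N` and `O Q` are both within `η W Q N` of `W Q N`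
  have e1 : P * N - W * Q * N ≤ η * (W * Q * N) := by nlinarith
  have e2 : -(η * (W * Q * N)) ≤ P * N - W * Q * N := by nlinarith
  have e3 : O * Q - W * Q * N ≤ η * (W * Q * N) := by nlinarith
  have e4 : -(η * (W * Q * N)) ≤ O * Q - W * Q * N := by nlinarith
  -- hence `W Q N ≤ 2 O Q`
  have e5 : W * Q * N ≤ 2 * (O * Q) := by nlinarith
  constructor <;> nlinarith

/-- Two relative-error ratio statements chain: with `0 ≤ P ≤ Q ≤ N`, `0 ≤ O ≤ N`, `Pz, Oz ≥ 0`,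
`0 ≤ η ≤ 1/2`, the statements `P·N ≈ O·Q` and `Q·Oz ≈ N·Pz` give `|P·Oz − O·Pz| ≤ 3η·O·Pz`.
[folklore] -/
theorem share_chain2 {P O Q N Pz Oz η : ℝ} (hη0 : 0 ≤ η) (hη1 : η ≤ 1 / 2)
    (hP : 0 ≤ P) (hPQ : P ≤ Q) (hO : 0 ≤ O) (hON : O ≤ N) (hQN : Q ≤ N)
    (hPz : 0 ≤ Pz) (hOz : 0 ≤ Oz)
    (h1 : |P * N - O * Q| ≤ η * (O * Q))
    (h2 : |Q * Oz - N * Pz| ≤ η * (N * Pz)) :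
    |P * Oz - O * Pz| ≤ 3 * η * (O * Pz) := by
  have hQ : 0 ≤ Q := hP.trans hPQ
  have hN : 0 ≤ N := hQ.trans hQN
  rw [abs_le] at h1 h2 ⊢
  obtain ⟨h1a, h1b⟩ := h1
  obtain ⟨h2a, h2b⟩ := h2
  rcases hN.eq_or_lt with hN0 | hN0
  · -- `N = 0`: everything on member `m` vanishes
    have hO0 : O = 0 := le_antisymm (hN0 ▸ hON) hO
    have hQ0 : Q = 0 := le_antisymm (hN0 ▸ hQN) hQ
    have hP0 : P = 0 := le_antisymm (hQ0 ▸ hPQ) hP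
    subst hO0; subst hP0
    constructor <;> nlinarith
  rcases hQ.eq_or_lt with hQ0 | hQ0
  · -- `Q = 0 < N`: then `P = 0` and `Pz = 0`
    have hP0 : P = 0 := le_antisymm (hQ0 ▸ hPQ) hP
    rw [← hQ0] at h2b
    have hNPz : N * Pz ≤ 0 := by nlinarith
    have hPz0 : Pz = 0 := le_antisymm (by nlinarith) hPz
    subst hP0; subst hPz0
    constructor <;> nlinarith
  -- main case `N, Q > 0`
  have hNQ : 0 < N * Q := mul_pos hN0 hQ0
  have u1 : P * N ≤ (1 + η) * (O * Q) := by linarith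
  have u2 : Q * Oz ≤ (1 + η) * (N * Pz) := by linarith
  have l1 : (1 - η) * (O * Q) ≤ P * N := by linarith
  have l2 : (1 - η) * (N * Pz) ≤ Q * Oz := by linarith
  have hPN : 0 ≤ P * N := mul_nonneg hP hN
  have h1η : 0 ≤ 1 - η := by linarith
  have up : (N * Q) * (P * Oz) ≤ (N * Q) * ((1 + η) ^ 2 * (O * Pz)) :=
    calc (N * Q) * (P * Oz) = (P * N) * (Q * Oz) := by ring
      _ ≤ ((1 + η) * (O * Q)) * ((1 + η) * (N * Pz)) :=
          mul_le_mul u1 u2 (mul_nonneg hQ hOz) (by positivity)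
      _ = (N * Q) * ((1 + η) ^ 2 * (O * Pz)) := by ring
  have lo : (N * Q) * ((1 - η) ^ 2 * (O * Pz)) ≤ (N * Q) * (P * Oz) :=
    calc (N * Q) * ((1 - η) ^ 2 * (O * Pz)) = ((1 - η) * (O * Q)) * ((1 - η) * (N * Pz)) := by ring
      _ ≤ (P * N) * (Q * Oz) :=
          mul_le_mul l1 l2 (mul_nonneg h1η (mul_nonneg hN hPz)) hPN
      _ = (N * Q) * (P * Oz) := by ring
  have up' : P * Oz ≤ (1 + η) ^ 2 * (O * Pz) := le_of_mul_le_mul_left up hNQ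
  have lo' : (1 - η) ^ 2 * (O * Pz) ≤ P * Oz := le_of_mul_le_mul_left lo hNQ
  have hOPz : 0 ≤ O * Pz := mul_nonneg hO hPz
  have hη2 : η ^ 2 ≤ η := by nlinarith
  constructor <;> nlinarith

/-- One member step from the three stubs, as pure real bookkeeping: with `0 ≤ c' ≤ c ≤ MO`,
`O ≥ 0`, `P > 0`, `A > 0` and `0 ≤ η ≤ 1/8`, the relative-error statements `c'·MO ≈ c·MP`,
`MP·O ≈ MO·P`, `P·A ≈ O` chain multiplicatively to `|c'A − c| ≤ 4η·c`. [folklore] -/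
theorem share_chain {c' c MO MP O P A η : ℝ}
    (hη0 : 0 ≤ η) (hη1 : η ≤ 1 / 8)
    (hc' : 0 ≤ c') (hc'c : c' ≤ c) (hcMO : c ≤ MO) (hO : 0 ≤ O)
    (hP : 0 < P) (hA : 0 < A)
    (hD : |c' * MO - c * MP| ≤ η * (c * MP))
    (hS : |MP * O - MO * P| ≤ η * (MO * P))
    (hZ : |P * A - O| ≤ η * O) :
    |c' * A - c| ≤ 4 * η * c := by
  have hc : 0 ≤ c := hc'.trans hc'c
  rcases hc.eq_or_lt with hc0 | hc0
  · have hc'0 : c' = 0 := le_antisymm (hc0 ▸ hc'c) hc'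
    rw [← hc0, hc'0]
    simp
  rw [abs_le] at hD hS hZ ⊢
  obtain ⟨hD1, hD2⟩ := hD
  obtain ⟨hS1, hS2⟩ := hS
  obtain ⟨hZ1, hZ2⟩ := hZ
  have hO0 : 0 < O := by
    rcases hO.eq_or_lt with h | h
    · rw [← h] at hZ2
      have hPA := mul_pos hP hA
      linarith
    · exact h
  have hMO0 : 0 < MO := hc0.trans_le hcMO
  have h1η : 0 ≤ 1 - η := by linarith
  -- upper bound
  have u1 : c' * MO ≤ (1 + η) * (c * MP) := by linarith
  have u2 : MP * O ≤ (1 + η) * (MO * P) := by linarith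
  have u3 : P * A ≤ (1 + η) * O := by linarith
  have key_u : MO * (c' * O) ≤ MO * ((1 + η) ^ 2 * c * P) :=
    calc MO * (c' * O) = (c' * MO) * O := by ring
      _ ≤ ((1 + η) * (c * MP)) * O := mul_le_mul_of_nonneg_right u1 hO
      _ = ((1 + η) * c) * (MP * O) := by ring
      _ ≤ ((1 + η) * c) * ((1 + η) * (MO * P)) :=
          mul_le_mul_of_nonneg_left u2 (mul_nonneg (by linarith) hc)
      _ = MO * ((1 + η) ^ 2 * c * P) := by ring
  have cu : c' * O ≤ (1 + η) ^ 2 * c * P := le_of_mul_le_mul_left key_u hMO0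
  have key_u2 : O * (c' * A) ≤ O * ((1 + η) ^ 3 * c) :=
    calc O * (c' * A) = (c' * O) * A := by ring
      _ ≤ ((1 + η) ^ 2 * c * P) * A := mul_le_mul_of_nonneg_right cu hA.le
      _ = ((1 + η) ^ 2 * c) * (P * A) := by ring
      _ ≤ ((1 + η) ^ 2 * c) * ((1 + η) * O) := mul_le_mul_of_nonneg_left u3 (by positivity)
      _ = O * ((1 + η) ^ 3 * c) := by ring
  have up : c' * A ≤ (1 + η) ^ 3 * c := le_of_mul_le_mul_left key_u2 hO0
  -- lower bound
  have l1 : (1 - η) * (c * MP) ≤ c' * MO := by linarith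
  have l2 : (1 - η) * (MO * P) ≤ MP * O := by linarith
  have l3 : (1 - η) * O ≤ P * A := by linarith
  have key_l : MO * ((1 - η) ^ 2 * c * P) ≤ MO * (c' * O) :=
    calc MO * ((1 - η) ^ 2 * c * P) = ((1 - η) * c) * ((1 - η) * (MO * P)) := by ring
      _ ≤ ((1 - η) * c) * (MP * O) := mul_le_mul_of_nonneg_left l2 (mul_nonneg h1η hc)
      _ = ((1 - η) * (c * MP)) * O := by ring
      _ ≤ (c' * MO) * O := mul_le_mul_of_nonneg_right l1 hO
      _ = MO * (c' * O) := by ring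
  have cl : (1 - η) ^ 2 * c * P ≤ c' * O := le_of_mul_le_mul_left key_l hMO0
  have key_l2 : O * ((1 - η) ^ 3 * c) ≤ O * (c' * A) :=
    calc O * ((1 - η) ^ 3 * c) = ((1 - η) ^ 2 * c) * ((1 - η) * O) := by ring
      _ ≤ ((1 - η) ^ 2 * c) * (P * A) := mul_le_mul_of_nonneg_left l3 (by positivity)
      _ = ((1 - η) ^ 2 * c * P) * A := by ring
      _ ≤ (c' * O) * A := mul_le_mul_of_nonneg_right cl hA.le
      _ = O * (c' * A) := by ring
  have lo : (1 - η) ^ 3 * c ≤ c' * A := le_of_mul_le_mul_left key_l2 hO0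
  -- polynomial bookkeeping for η ≤ 1/8
  have p2' : η * η ≤ η * (1 / 8) := mul_le_mul_of_nonneg_left hη1 hη0
  have p2 : η ^ 2 ≤ η / 8 := by rw [sq]; linarith
  have p3' : η * η ^ 2 ≤ η * (η / 8) := mul_le_mul_of_nonneg_left p2 hη0
  have p3 : η ^ 3 ≤ η / 64 := by
    have e3 : η ^ 3 = η * η ^ 2 := by ring
    have e4 : η * (η / 8) = η ^ 2 / 8 := by ring
    rw [e3]; rw [e4] at p3'
    linarith
  have hsq : 0 ≤ η ^ 2 := sq_nonneg η
  have x1 : (1 + η) ^ 3 = 1 + 3 * η + 3 * η ^ 2 + η ^ 3 := by ring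
  have x2 : (1 - η) ^ 3 = 1 - 3 * η + 3 * η ^ 2 - η ^ 3 := by ring
  have e1 : (1 + η) ^ 3 ≤ 1 + 4 * η := by rw [x1]; linarith
  have e2 : 1 - 4 * η ≤ (1 - η) ^ 3 := by rw [x2]; linarith
  have f1 := mul_le_mul_of_nonneg_right e1 hc
  have f2 := mul_le_mul_of_nonneg_right e2 hc
  constructor <;> nlinarith

/-! ### Iterated-limit bookkeeping `∀ η > 0, ∃ U₀, ∀ U ≥ U₀, eventually in x` over abstract cells -/

/-- **S' = S'a ∧ S'b** over abstract cells: two one-sided sieve decouplings `P ≈ W·Q`, `O ≈ W·N`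
with the same factor `W ≥ 0` give the ratio decoupling `P·N ≈ O·Q`. [folklore] -/
theorem ratio_ev {P O Q N : ℝ → ℕ → ℕ} {W : ℝ → ℕ → ℝ} (hW : ∀ U x, 0 ≤ W U x)
    (ha : ∀ η : ℝ, 0 < η → ∃ U₀ : ℝ, ∀ U : ℝ, U₀ ≤ U → ∀ᶠ x : ℕ in atTop,
      |(P U x : ℝ) - W U x * (Q U x : ℝ)| ≤ η * (W U x * (Q U x : ℝ)))
    (hb : ∀ η : ℝ, 0 < η → ∃ U₀ : ℝ, ∀ U : ℝ, U₀ ≤ U → ∀ᶠ x : ℕ in atTop,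
      |(O U x : ℝ) - W U x * (N U x : ℝ)| ≤ η * (W U x * (N U x : ℝ))) :
    ∀ η : ℝ, 0 < η → ∃ U₀ : ℝ, ∀ U : ℝ, U₀ ≤ U → ∀ᶠ x : ℕ in atTop,
      |(P U x : ℝ) * (N U x : ℝ) - (O U x : ℝ) * (Q U x : ℝ)|
        ≤ η * ((O U x : ℝ) * (Q U x : ℝ)) := by
  intro η hη
  have hη' : 0 < min (η / 4) (1 / 2) := lt_min (by positivity) (by norm_num)
  obtain ⟨U₁, h₁⟩ := ha _ hη'
  obtain ⟨U₂, h₂⟩ := hb _ hη'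
  refine ⟨max U₁ U₂, fun U hU => ?_⟩
  obtain ⟨hU₁, hU₂⟩ := max_le_iff.1 hU
  filter_upwards [h₁ U hU₁, h₂ U hU₂] with x h1x h2x
  have key := share_ratio_of_factor hη'.le (min_le_right _ _) (hW U x)
    (Nat.cast_nonneg _) (Nat.cast_nonneg _) h1x h2x
  calc _ ≤ 4 * min (η / 4) (1 / 2) * ((O U x : ℝ) * Q U x) := key
    _ ≤ η * ((O U x : ℝ) * Q U x) := by
        apply mul_le_mul_of_nonneg_right _ (by positivity)
        linarith [min_le_left (η / 4) (1 / 2)]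

/-- **S = S' ∘ S''** over abstract cells: with `P ≤ Q ≤ N`, `O ≤ N`, the ratio statements
`P·N ≈ O·Q` and `Q·Oz ≈ N·Pz` give `P·Oz ≈ O·Pz`. [folklore] -/
theorem sifted_ev {P O Q N Pz Oz : ℝ → ℕ → ℕ}
    (hPQ : ∀ U x, P U x ≤ Q U x) (hON : ∀ U x, O U x ≤ N U x) (hQN : ∀ U x, Q U x ≤ N U x)
    (h1 : ∀ η : ℝ, 0 < η → ∃ U₀ : ℝ, ∀ U : ℝ, U₀ ≤ U → ∀ᶠ x : ℕ in atTop,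
      |(P U x : ℝ) * (N U x : ℝ) - (O U x : ℝ) * (Q U x : ℝ)| ≤ η * ((O U x : ℝ) * (Q U x : ℝ)))
    (h2 : ∀ η : ℝ, 0 < η → ∃ U₀ : ℝ, ∀ U : ℝ, U₀ ≤ U → ∀ᶠ x : ℕ in atTop,
      |(Q U x : ℝ) * (Oz U x : ℝ) - (N U x : ℝ) * (Pz U x : ℝ)|
        ≤ η * ((N U x : ℝ) * (Pz U x : ℝ))) :
    ∀ η : ℝ, 0 < η → ∃ U₀ : ℝ, ∀ U : ℝ, U₀ ≤ U → ∀ᶠ x : ℕ in atTop,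
      |(P U x : ℝ) * (Oz U x : ℝ) - (O U x : ℝ) * (Pz U x : ℝ)|
        ≤ η * ((O U x : ℝ) * (Pz U x : ℝ)) := by
  intro η hη
  have hη' : 0 < min (η / 3) (1 / 2) := lt_min (by positivity) (by norm_num)
  obtain ⟨U₁, h₁⟩ := h1 _ hη'
  obtain ⟨U₂, h₂⟩ := h2 _ hη'
  refine ⟨max U₁ U₂, fun U hU => ?_⟩
  obtain ⟨hU₁, hU₂⟩ := max_le_iff.1 hU
  filter_upwards [h₁ U hU₁, h₂ U hU₂] with x h1x h2x
  have key := share_chain2 hη'.le (min_le_right _ _) (Nat.cast_nonneg _)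
    (by exact_mod_cast hPQ U x) (Nat.cast_nonneg _)
    (by exact_mod_cast hON U x) (by exact_mod_cast hQN U x)
    (Nat.cast_nonneg _) (Nat.cast_nonneg _) h1x h2x
  calc _ ≤ 3 * min (η / 3) (1 / 2) * ((O U x : ℝ) * Pz U x) := key
    _ ≤ η * ((O U x : ℝ) * Pz U x) := by
        apply mul_le_mul_of_nonneg_right _ (by positivity)
        linarith [min_le_left (η / 3) (1 / 2)]

/-- **The member step** over abstract cells: with `c' ≤ c ≤ MO`, `P > 0` eventually (for `U ≥ 2`)
and `A(U) > 0` (`U > 0`), the statements D `c'·MO ≈ c·MP`, S `MP·O ≈ MO·P` and Z `P·A ≈ O` give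
`|c'·A(U) − c| ≤ η·c` for `U ≥ U₀(η)`, eventually in `x`. [folklore] -/
theorem memberStep_ev {c' c MO MP O P : ℝ → ℕ → ℕ} {A : ℝ → ℝ}
    (hc'c : ∀ U x, c' U x ≤ c U x) (hcMO : ∀ U x, c U x ≤ MO U x)
    (hP : ∀ U : ℝ, 2 ≤ U → ∀ᶠ x : ℕ in atTop, 0 < P U x) (hA : ∀ U : ℝ, 0 < U → 0 < A U)
    (hD : ∀ η : ℝ, 0 < η → ∃ U₀ : ℝ, ∀ U : ℝ, U₀ ≤ U → ∀ᶠ x : ℕ in atTop,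
      |(c' U x : ℝ) * (MO U x : ℝ) - (c U x : ℝ) * (MP U x : ℝ)| ≤ η * ((c U x : ℝ) * (MP U x : ℝ)))
    (hS : ∀ η : ℝ, 0 < η → ∃ U₀ : ℝ, ∀ U : ℝ, U₀ ≤ U → ∀ᶠ x : ℕ in atTop,
      |(MP U x : ℝ) * (O U x : ℝ) - (MO U x : ℝ) * (P U x : ℝ)| ≤ η * ((MO U x : ℝ) * (P U x : ℝ)))
    (hZ : ∀ η : ℝ, 0 < η → ∃ U₀ : ℝ, ∀ U : ℝ, U₀ ≤ U → ∀ᶠ x : ℕ in atTop,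
      |(P U x : ℝ) * A U - (O U x : ℝ)| ≤ η * (O U x : ℝ)) :
    ∀ η : ℝ, 0 < η → ∃ U₀ : ℝ, ∀ U : ℝ, U₀ ≤ U → ∀ᶠ x : ℕ in atTop,
      |(c' U x : ℝ) * A U - (c U x : ℝ)| ≤ η * (c U x : ℝ) := by
  intro η hη
  have hη' : 0 < min (η / 4) (1 / 8) := lt_min (by positivity) (by norm_num)
  obtain ⟨U₁, h₁⟩ := hD _ hη'
  obtain ⟨U₂, h₂⟩ := hS _ hη'
  obtain ⟨U₃, h₃⟩ := hZ _ hη'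
  refine ⟨max (max U₁ U₂) (max U₃ 2), fun U hU => ?_⟩
  simp only [max_le_iff] at hU
  obtain ⟨⟨hU₁, hU₂⟩, hU₃, hU2⟩ := hU
  have hU0 : 0 < U := by linarith
  filter_upwards [h₁ U hU₁, h₂ U hU₂, h₃ U hU₃, hP U hU2] with x hDx hSx hZx hPx
  have key := share_chain hη'.le (min_le_right _ _) (Nat.cast_nonneg _)
    (by exact_mod_cast hc'c U x) (by exact_mod_cast hcMO U x)
    (Nat.cast_nonneg _) (by exact_mod_cast hPx) (hA U hU0) hDx hSx hZx
  calc _ ≤ 4 * min (η / 4) (1 / 8) * (c U x : ℝ) := key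
    _ ≤ η * (c U x : ℝ) := by
        apply mul_le_mul_of_nonneg_right _ (Nat.cast_nonneg _)
        linarith [min_le_left (η / 4) (1 / 8)]

end ShareOfDecoupling

/-- **Sub-goal (the member step's real bookkeeping)** of the stub `stub_shareOfDecoupling` (crux
stmt-Parity-15629, line `birth`): with `0 ≤ c⁽ᵐ⁺¹⁾ ≤ c⁽ᵐ⁾ ≤ O_m`, `O_ℤ ≥ 0`, `P_ℤ > 0`, `A > 0`,
`0 ≤ η ≤ 1/8`, the three relative-error statements D `c⁽ᵐ⁺¹⁾·O_m ≈ c⁽ᵐ⁾·P_m`, S `P_m·O_ℤ ≈ O_m·P_ℤ`,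
Z `P_ℤ·A ≈ O_ℤ` give `|c⁽ᵐ⁺¹⁾·A − c⁽ᵐ⁾| ≤ 4η·c⁽ᵐ⁾` (`ShareOfDecoupling.share_chain`). [folklore] -/
theorem stub_shareChain :
    ∀ (cn cm MO MP O P A η : ℝ), 0 ≤ η → η ≤ 1 / 8 → 0 ≤ cn → cn ≤ cm → cm ≤ MO → 0 ≤ O → 0 < P → 0
    < A → |cn * MO - cm * MP| ≤ η * (cm * MP) → |MP * O - MO * P| ≤ η * (MO * P) → |P * A - O| ≤ η *
    O → |cn * A - cm| ≤ 4 * η * cm :=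
  fun _ _ _ _ _ _ _ _ hη0 hη1 hc' hc'c hcMO hO hP hA hD hS hZ =>
    ShareOfDecoupling.share_chain hη0 hη1 hc' hc'c hcMO hO hP hA hD hS hZ

end Summit.Parity.BatemanHorn.Cruxes.OddSectorShareLinear.Birth

end
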